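import Mathlib
import HarnessLib
import Summits.Parity.GeneralizedHardyLittlewood.Theorems.LeeYangFibresModelHyperbolicity
import Literature.NumberTheory.Sieve.RoughNumbersClassesBuchstabIdentity
import Literature.NumberTheory.Sieve.RoughNumbersClassesSqrtRange

/-!
# Stub `stub_apCells` of line `SketchIdeator1` (model transfer) for crux
# `LeeYangFibres.FibreHyperbolicity` (stmt-Parity-14108): Alladi's Ω-cell asymptotic in a residue class

`APCellAsymptotic`, unfolded: for `q ≥ 1`, every `i, k` and `ε > 0` there is `X₀` such that, uniformly
in `r` prime to `q` and in `2 ≤ Y ≤ X ≤ Y^k`, `X ≥ X₀`,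
`|#{n ≤ X : n ≡ r (q), P⁻(n) ≥ ⌈Y⌉, Ω(n) = i+1} − (X I_{i+1}(log X/log Y)/log X − [i=0] Y/log Y)/φ(q)| ≤ ε X/log Y`
(`I_{i+1} = cellDensity i`). Parity-free; no named fact is used. Proof, in the tree's `(X, Y)`-format:
(A) DIFFERENCES between two reduced classes of the `Ω = i+1` cell of `roughIcc ⌈Y⌉₊ ⌊X⌋₊` are
`o(X/log Y)` (`abs_card_cell_class_sub_le`, induction on `i`): the cell `Ω = 1` is the set of primes
of `[⌈Y⌉, ⌊X⌋]`, so the base is the prime number theorem in arithmetic progressions in difference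
form (`RoughAP.exists_forall_abs_primeCountingMod_sub_le`); the step is Buchstab's identity in classes
(`RoughAP.card_filter_roughIcc_eq_add_sum`, `M = ⌊X⌋ + 1`) with `Ω(p m) = Ω(m) + 1`,
`p m ≡ c ↔ m ≡ p⁻¹ c`, the induction hypothesis at `(X/p, p)` (`p² ≤ X`; for `p² > X` the cells are
empty) and `∑_{Y ≤ p ≤ X} 1/p = O_k(1)` (`sum_primes_Ioc_inv_le`). (B) The `φ(q)` reduced classes
partition the cell (`Y > q`), of size `omegaCell ⌈Y⌉₊ ⌊X⌋₊ (i+1) = main ± C X/log² Y` by the landed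
`CellRate` (`stub_cellRate stub_calculus`). (C) Class `r` = total/`φ(q)` ± the largest difference, and
`C X/log² Y ≤ (ε/2) X/log Y` once `log Y ≥ 2C/ε`, which `X ≥ X₁^k`, `log X ≤ k log Y` enforce.
References: Alladi, Quart. J. Math. Oxford 33 (1982) [Alladi1982]; Tenenbaum III.6 [Tenenbaum2015];
Montgomery–Vaughan, Cor. 11.20 [MontgomeryVaughan2007].
-/

noncomputable section

namespace Summit.Parity.GeneralizedHardyLittlewood.Cruxes.FibreHyperbolicity.ModelTransfer

open scoped BigOperators Classical
open Finset Polynomial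
open Literature.NumberTheory.Sieve
open Summit.Parity.GeneralizedHardyLittlewood.Cruxes.ModelHyperbolicity.WindowChainTransport (cellDensity)
open Summit.Parity.GeneralizedHardyLittlewood.Cruxes.ModelHyperbolicity.WindowChainTransport
  (omegaCell omegaCell_succ_eq_card_filter stub_cellRate stub_calculus)
open scoped ArithmeticFunction.Omega

/-- The set counted in `APCellAsymptotic` is the class `r mod q` of the `Ω = i+1` cell of the tree's
`roughIcc N XX` (for `n` with `Ω(n) ≥ 1`, "`N ≤ P⁻(n)`" iff "every prime factor of `n` is `≥ N`"). -/
private theorem filter_class_cell_eq (q r N XX i : ℕ) :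
    (Finset.Icc 1 XX).filter (fun n => n ≡ r [MOD q] ∧ N ≤ Nat.minFac n ∧
        ArithmeticFunction.cardFactors n = i + 1) =
      ((roughIcc N XX).filter (fun b => Ω b = i + 1)).filter (· ≡ r [MOD q]) := by
  ext n
  simp only [Finset.mem_filter, mem_roughIcc, Finset.mem_Icc]
  constructor
  · rintro ⟨hn, hr, hN, hΩ⟩
    exact ⟨⟨⟨hn, fun p hp hpn => hN.trans (Nat.minFac_le_of_dvd hp.two_le hpn)⟩, hΩ⟩, hr⟩
  · rintro ⟨⟨⟨hn, hall⟩, hΩ⟩, hr⟩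
    refine ⟨hn, hr, ?_, hΩ⟩
    have hn1 : n ≠ 1 := by rintro rfl; simp at hΩ
    exact hall _ (Nat.minFac_prime hn1) (Nat.minFac_dvd n)

/-- For `N > q ≥ 1` every `N`-rough number is prime to `q` (`RoughAP.coprime_of_mem_roughIcc`), so a
set `S` of `N`-rough numbers splits into its reduced classes:
`#S = ∑_{c < q, (q, c) = 1} #{b ∈ S : b ≡ c (mod q)}` (the index set is the one of `Nat.totient`). -/
private theorem card_eq_sum_card_filter_of_subset {q N XX : ℕ} (hq : 0 < q) (hqN : q < N)
    {S : Finset ℕ} (hS : S ⊆ roughIcc N XX) :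
    #S = ∑ c ∈ (range q).filter (Nat.Coprime q), #(S.filter (· ≡ c [MOD q])) := by
  rw [card_eq_sum_card_fiberwise (f := fun b => b % q) (t := (range q).filter (Nat.Coprime q))]
  · refine sum_congr rfl fun c hc => ?_
    rw [mem_filter, mem_range] at hc
    congr 1
    refine filter_congr fun b _ => ?_
    rw [Nat.ModEq, Nat.mod_eq_of_lt hc.1]
  · intro b hb
    simp only [Finset.mem_coe] at hb ⊢
    rw [Finset.mem_filter, Finset.mem_range]
    exact ⟨Nat.mod_lt b hq,
      ((RoughAP.coprime_mod_iff b).mpr (RoughAP.coprime_of_mem_roughIcc hq hqN (hS hb))).symm⟩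

/-- The thresholds: if `X ≥ X₁^k` (`X₁ > 0`), `2 ≤ Y ≤ X` and `log X ≤ k log Y`, then `X₁ ≤ Y`
(`k = 0` is vacuous, as then `log X ≤ 0 < log 2`). -/
private theorem le_of_pow_le_of_log_le {X₁ X Y : ℝ} {k : ℕ} (hX₁ : 0 < X₁) (hY : 2 ≤ Y)
    (hYX : Y ≤ X) (hX : X₁ ^ k ≤ X) (hlog : Real.log X ≤ k * Real.log Y) : X₁ ≤ Y := by
  have hlX : 0 < Real.log X := Real.log_pos (by linarith)
  rcases Nat.eq_zero_or_pos k with rfl | hk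
  · simp at hlog; linarith
  have h1 : (k : ℝ) * Real.log X₁ ≤ Real.log X := by
    rw [← Real.log_pow]; exact Real.log_le_log (pow_pos hX₁ k) hX
  exact (Real.log_le_log_iff hX₁ (by linarith)).mp
    (le_of_mul_le_mul_left (h1.trans hlog) (by exact_mod_cast hk))

/-- Step (C), the arithmetic: if `|∑_{c ∈ R} f c − Mn| ≤ E` (the total against the main term) and
`|A − f c| ≤ D` for all `c ∈ R` (the differences), `#R = t > 0`, then `|A − Mn/t| ≤ D + E/t`. -/
private theorem abs_sub_div_le_of_sum {ι : Type*} (R : Finset ι) (f : ι → ℝ) {A Mn E D t : ℝ}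
    (ht : (#R : ℝ) = t) (ht0 : 0 < t) (hrate : |∑ c ∈ R, f c - Mn| ≤ E)
    (hdiff : ∀ c ∈ R, |A - f c| ≤ D) : |A - Mn / t| ≤ D + E / t := by
  have hsum : |t * A - ∑ c ∈ R, f c| ≤ t * D := by
    rw [show t * A - ∑ c ∈ R, f c = ∑ c ∈ R, (A - f c) by
      rw [Finset.sum_sub_distrib, Finset.sum_const, nsmul_eq_mul, ht]]
    calc |∑ c ∈ R, (A - f c)| ≤ ∑ c ∈ R, |A - f c| := Finset.abs_sum_le_sum_abs _ _
      _ ≤ ∑ c ∈ R, D := Finset.sum_le_sum hdiff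
      _ = t * D := by rw [Finset.sum_const, nsmul_eq_mul, ht]
  rw [show A - Mn / t = (t * A - Mn) / t by field_simp, abs_div, abs_of_pos ht0, div_le_iff₀ ht0,
    show t * A - Mn = (t * A - ∑ c ∈ R, f c) + (∑ c ∈ R, f c - Mn) by ring]
  calc _ ≤ t * D + E := (abs_add_le _ _).trans (add_le_add hsum hrate)
    _ = (D + E / t) * t := by field_simp

/-- **Base `i = 0`.** The cell `Ω = 1` of `roughIcc ⌈Y⌉₊ ⌊X⌋₊` is the set of primes of `[⌈Y⌉, ⌊X⌋]`,
so a difference of two reduced classes is `(π(⌊X⌋;q,c) − π(⌊X⌋;q,c')) − (π(⌈Y⌉−1;q,c) − π(⌈Y⌉−1;q,c'))`,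
`≤ (ε/2)(⌊X⌋/log ⌊X⌋ + (⌈Y⌉−1)/log(⌈Y⌉−1)) ≤ ε X/log Y` (PNT in progressions, `Y ≥ X^{1/k}` large). -/
private theorem abs_card_cell_class_sub_le_base {q : ℕ} (hq : 0 < q) (k : ℕ) {ε : ℝ} (hε : 0 < ε) :
    ∃ X₀ : ℝ, ∀ X Y : ℝ, X₀ ≤ X → 2 ≤ Y → Y ≤ X → Real.log X ≤ k * Real.log Y → (q : ℝ) < Y →
      ∀ c c' : ℕ, c.Coprime q → c'.Coprime q →
        |(#(((roughIcc ⌈Y⌉₊ ⌊X⌋₊).filter (fun b => Ω b = 0 + 1)).filter (· ≡ c [MOD q])) : ℝ) -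
            #(((roughIcc ⌈Y⌉₊ ⌊X⌋₊).filter (fun b => Ω b = 0 + 1)).filter (· ≡ c' [MOD q]))| ≤
          ε * X / Real.log Y := by
  obtain ⟨n₀, hn₀⟩ := RoughAP.exists_forall_abs_primeCountingMod_sub_le hq (half_pos hε)
  -- `t ↦ t/log t` is monotone on `[e, ∞)`
  have hmono : ∀ s t : ℝ, Real.exp 1 ≤ s → s ≤ t → s / Real.log s ≤ t / Real.log t := by
    intro s t hs hst
    have hs0 : 0 < s := (Real.exp_pos 1).trans_le hs
    have hls : 1 ≤ Real.log s := by rw [Real.le_log_iff_exp_le hs0]; exact hs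
    have hlt : 1 ≤ Real.log t := hls.trans (Real.log_le_log hs0 hst)
    have h := Real.log_div_self_antitoneOn (Set.mem_Ici.mpr hs) (Set.mem_Ici.mpr (hs.trans hst)) hst
    rw [div_le_div_iff₀ (hs0.trans_le hst) hs0] at h
    rw [div_le_div_iff₀ (by linarith) (by linarith)]
    linarith
  have hn₀0 : (0 : ℝ) ≤ n₀ := Nat.cast_nonneg _
  refine ⟨((n₀ : ℝ) + 4) ^ k, fun X Y hX hY2 hYX hlog _ c c' hc hc' => ?_⟩
  have hYn : (n₀ : ℝ) + 4 ≤ Y := le_of_pow_le_of_log_le (by linarith) hY2 hYX hX hlog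
  have hy0 : 0 < Y := by linarith
  have hx0 : 0 < X := by linarith
  have hly : 0 < Real.log Y := Real.log_pos (by linarith)
  have hYN : Y ≤ ⌈Y⌉₊ := Nat.le_ceil Y
  have hNY : (⌈Y⌉₊ : ℝ) < Y + 1 := Nat.ceil_lt_add_one hy0.le
  have hXXX : (⌊X⌋₊ : ℝ) ≤ X := Nat.floor_le hx0.le
  have hN1 : 1 ≤ ⌈Y⌉₊ := Nat.ceil_pos.mpr hy0
  have hNn : n₀ + 4 ≤ ⌈Y⌉₊ := by
    have : ((n₀ + 4 : ℕ) : ℝ) ≤ ⌈Y⌉₊ := by push_cast; linarith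
    exact_mod_cast this
  have hNXX : ⌈Y⌉₊ ≤ ⌊X⌋₊ + 1 := (Nat.ceil_le_ceil hYX).trans (Nat.ceil_le_floor_add_one X)
  -- the cells `Ω = 1` are the primes of `[⌈Y⌉, ⌊X⌋]`, counted by `π(⌊X⌋; q, ·) − π(⌈Y⌉ − 1; q, ·)`
  have eT : ∀ a : ℕ, (#(((Icc ⌈Y⌉₊ ⌊X⌋₊).filter Nat.Prime).filter (· ≡ a [MOD q])) : ℝ) =
      (ParityWave0.primeCountingMod q a ⌊X⌋₊ : ℝ) - ParityWave0.primeCountingMod q a (⌈Y⌉₊ - 1) := by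
    intro a
    rw [← RoughAP.card_primes_Icc_filter_add (q := q) (c := a) hN1 hNXX]; push_cast; ring
  rw [Nat.zero_add, roughIcc_filter_cardFactors_one, eT c, eT c']
  -- the prime number theorem in the two classes, at `⌊X⌋` and at `⌈Y⌉ - 1`
  have hPX := hn₀ ⌊X⌋₊ (by omega) c c' hc hc'
  have hPN := hn₀ (⌈Y⌉₊ - 1) (by omega) c c' hc hc'
  -- sizes: `⌊X⌋/log ⌊X⌋ ≤ X/log Y`, `(⌈Y⌉-1)/log(⌈Y⌉-1) ≤ X/log Y`
  have hXX3 : (3 : ℝ) ≤ ⌊X⌋₊ := by exact_mod_cast (show 3 ≤ ⌊X⌋₊ by omega)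
  have he := Real.exp_one_lt_d9
  have hb1 : (⌊X⌋₊ : ℝ) / Real.log ⌊X⌋₊ ≤ X / Real.log Y :=
    (hmono _ _ (by linarith) hXXX).trans
      (div_le_div_of_nonneg_left hx0.le hly (Real.log_le_log hy0 hYX))
  have hN1R : ((⌈Y⌉₊ - 1 : ℕ) : ℝ) = (⌈Y⌉₊ : ℝ) - 1 := by rw [Nat.cast_sub hN1, Nat.cast_one]
  have hb2 : ((⌈Y⌉₊ - 1 : ℕ) : ℝ) / Real.log ((⌈Y⌉₊ - 1 : ℕ) : ℝ) ≤ X / Real.log Y := by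
    rw [hN1R]
    exact (hmono _ _ (by linarith) (by linarith)).trans (div_le_div_of_nonneg_right hYX hly.le)
  -- assembly
  have e : ∀ A A' B B' : ℝ, A - B - (A' - B') = (A - A') - (B - B') := fun _ _ _ _ => by ring
  rw [e]
  calc _ ≤ _ := abs_sub _ _
    _ ≤ _ := add_le_add hPX hPN
    _ ≤ ε / 2 * (X / Real.log Y) + ε / 2 * (X / Real.log Y) := by
        rw [mul_div_assoc, mul_div_assoc]
        exact add_le_add (mul_le_mul_of_nonneg_left hb1 (by positivity))
          (mul_le_mul_of_nonneg_left hb2 (by positivity))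
    _ = ε * X / Real.log Y := by ring

/-- **Step `i → i + 1`.** Buchstab's identity in the class `c` with `M = ⌊X⌋ + 1` (the sifted term is
empty) reads `#{Ω = i+2, ≡ c} = ∑_{⌈Y⌉ ≤ p ≤ ⌊X⌋} #{m ∈ roughIcc p (⌊X⌋/p) : Ω m = i+1, m ≡ p⁻¹c}`; for
`p² ≤ X` the induction hypothesis at `(X/p, p)` bounds the difference of two classes by
`(ε/K) X/(p log Y)`, for `p² > X` both cells are empty, and `∑_{Y ≤ p ≤ X} 1/p < K`. -/
private theorem abs_card_cell_class_sub_le_step {q : ℕ} (hq : 0 < q) (i : ℕ)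
    (ih : ∀ (k : ℕ) (ε : ℝ), 0 < ε → ∃ X₀ : ℝ, ∀ X Y : ℝ, X₀ ≤ X → 2 ≤ Y → Y ≤ X →
      Real.log X ≤ k * Real.log Y → (q : ℝ) < Y → ∀ c c' : ℕ, c.Coprime q → c'.Coprime q →
        |(#(((roughIcc ⌈Y⌉₊ ⌊X⌋₊).filter (fun b => Ω b = i + 1)).filter (· ≡ c [MOD q])) : ℝ) -
            #(((roughIcc ⌈Y⌉₊ ⌊X⌋₊).filter (fun b => Ω b = i + 1)).filter (· ≡ c' [MOD q]))| ≤
          ε * X / Real.log Y)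
    (k : ℕ) {ε : ℝ} (hε : 0 < ε) :
    ∃ X₀ : ℝ, ∀ X Y : ℝ, X₀ ≤ X → 2 ≤ Y → Y ≤ X → Real.log X ≤ k * Real.log Y → (q : ℝ) < Y →
      ∀ c c' : ℕ, c.Coprime q → c'.Coprime q →
        |(#(((roughIcc ⌈Y⌉₊ ⌊X⌋₊).filter (fun b => Ω b = i + 1 + 1)).filter (· ≡ c [MOD q])) : ℝ) -
            #(((roughIcc ⌈Y⌉₊ ⌊X⌋₊).filter (fun b => Ω b = i + 1 + 1)).filter
              (· ≡ c' [MOD q]))| ≤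
          ε * X / Real.log Y := by
  obtain ⟨C₀, hC₀, hE⟩ := Literature.NumberTheory.LFunctions.exists_abs_theta_sub_self_le_div_log_sq
  set K : ℝ := (1 + 2 * C₀) * (2 * k) + 2 * C₀ + 1 with hK
  have hK0 : 0 < K := by positivity
  have hKne : K ≠ 0 := hK0.ne'
  obtain ⟨X₀', hX₀'⟩ := ih k (ε / K) (div_pos hε hK0)
  have hX₁0 : 0 < max X₀' 4 := lt_of_lt_of_le (by norm_num) (le_max_right _ _)
  refine ⟨(max X₀' 4) ^ k, fun X Y hX hY2 hYX hlog hqY c c' hc hc' => ?_⟩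
  have hX₁Y : max X₀' 4 ≤ Y := le_of_pow_le_of_log_le hX₁0 hY2 hYX hX hlog
  have hY4 : 4 ≤ Y := le_trans (le_max_right _ _) hX₁Y
  have hYX₀' : X₀' ≤ Y := le_trans (le_max_left _ _) hX₁Y
  have hy0 : 0 < Y := by linarith
  have hx0 : 0 < X := by linarith
  have hly : 0 < Real.log Y := Real.log_pos (by linarith)
  have hYN : Y ≤ ⌈Y⌉₊ := Nat.le_ceil Y
  have hNY : (⌈Y⌉₊ : ℝ) < Y + 1 := Nat.ceil_lt_add_one hy0.le
  have hN1 : 1 ≤ ⌈Y⌉₊ := Nat.ceil_pos.mpr hy0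
  have hNXX : ⌈Y⌉₊ ≤ ⌊X⌋₊ + 1 := (Nat.ceil_le_ceil hYX).trans (Nat.ceil_le_floor_add_one X)
  -- the sifted term of Buchstab's identity with `M = ⌊X⌋ + 1` is empty
  have hfirst : ∀ a : ℕ,
      #((roughIcc (⌊X⌋₊ + 1) ⌊X⌋₊).filter (fun b => Ω b = i + 1 + 1 ∧ b ≡ a [MOD q])) = 0 := by
    intro a
    rw [Finset.card_eq_zero, Finset.filter_eq_empty_iff]
    intro b hb hP
    have he := roughIcc_filter_cardFactors_eq_empty (N := ⌊X⌋₊ + 1) (X := ⌊X⌋₊) (j := i + 1 + 1)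
      ((Nat.lt_succ_self _).trans_le (Nat.le_self_pow (by omega) _))
    rw [Finset.filter_eq_empty_iff] at he
    exact he hb hP.1
  -- Buchstab's identity in the class `a`
  have hB : ∀ a : ℕ,
      (#(((roughIcc ⌈Y⌉₊ ⌊X⌋₊).filter (fun b => Ω b = i + 1 + 1)).filter (· ≡ a [MOD q])) : ℝ) =
      ∑ p ∈ (Ico ⌈Y⌉₊ (⌊X⌋₊ + 1)).filter Nat.Prime,
        (#((roughIcc p (⌊X⌋₊ / p)).filter
          (fun m => Ω (p * m) = i + 1 + 1 ∧ p * m ≡ a [MOD q])) : ℝ) := by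
    intro a
    rw [Finset.filter_filter, RoughAP.card_filter_roughIcc_eq_add_sum hNXX ⌊X⌋₊
      (fun b => Ω b = i + 1 + 1 ∧ b ≡ a [MOD q]), hfirst a, zero_add, Nat.cast_sum]
  -- the terms at `(X / p, p)`
  have hterm : ∀ p ∈ (Ico ⌈Y⌉₊ (⌊X⌋₊ + 1)).filter Nat.Prime,
      |(#((roughIcc p (⌊X⌋₊ / p)).filter
          (fun m => Ω (p * m) = i + 1 + 1 ∧ p * m ≡ c [MOD q])) : ℝ) -
        #((roughIcc p (⌊X⌋₊ / p)).filter
          (fun m => Ω (p * m) = i + 1 + 1 ∧ p * m ≡ c' [MOD q]))| ≤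
      ε / K * X / Real.log Y * (p : ℝ)⁻¹ := by
    intro p hp
    rw [Finset.mem_filter, Finset.mem_Ico] at hp
    obtain ⟨⟨hNp, -⟩, hpP⟩ := hp
    have hp2 : (2 : ℝ) ≤ p := by exact_mod_cast hpP.two_le
    have hp0 : (0 : ℝ) < p := by linarith
    have hYp : Y ≤ p := hYN.trans (by exact_mod_cast hNp)
    have hqp : (q : ℝ) < p := hqY.trans_le hYp
    have hpq : p.Coprime q := Nat.coprime_of_lt_prime hq.ne' (by exact_mod_cast hqp) hpP
    obtain ⟨d, hd, hiff⟩ := RoughAP.exists_coprime_mul_modEq_iff hq hpq hc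
    obtain ⟨d', hd', hiff'⟩ := RoughAP.exists_coprime_mul_modEq_iff hq hpq hc'
    -- `Ω(p m) = i + 2 ↔ Ω(m) = i + 1` for `m ≥ 1`, and `p m ≡ a ↔ m ≡ p⁻¹ a`
    have hΩ : ∀ m ∈ roughIcc p (⌊X⌋₊ / p), (Ω (p * m) = i + 1 + 1 ↔ Ω m = i + 1) := by
      intro m hm
      have hm0 : m ≠ 0 := Nat.one_le_iff_ne_zero.mp (mem_roughIcc.mp hm).1.1
      rw [ArithmeticFunction.cardFactors_mul hpP.ne_zero hm0,
        ArithmeticFunction.cardFactors_apply_prime hpP]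
      omega
    have hfc : ∀ a e : ℕ, (∀ m : ℕ, p * m ≡ a [MOD q] ↔ m ≡ e [MOD q]) →
        (roughIcc p (⌊X⌋₊ / p)).filter (fun m => Ω (p * m) = i + 1 + 1 ∧ p * m ≡ a [MOD q]) =
          ((roughIcc ⌈(p : ℝ)⌉₊ ⌊X / p⌋₊).filter (fun b => Ω b = i + 1)).filter
            (· ≡ e [MOD q]) := by
      intro a e he
      rw [Finset.filter_filter, Nat.ceil_natCast, Nat.floor_div_natCast]
      exact Finset.filter_congr fun m hm => and_congr (hΩ m hm) (he m)
    rw [hfc c d hiff, hfc c' d' hiff']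
    have hlyp : Real.log Y ≤ Real.log p := Real.log_le_log hy0 hYp
    have hlogp : 0 < Real.log p := hly.trans_le hlyp
    rcases le_or_gt (p : ℝ) (X / p) with hpp | hpp
    · -- `p² ≤ X`: the induction hypothesis at `(X / p, p)`
      have hlogXp : Real.log (X / p) ≤ k * Real.log p := by
        rw [Real.log_div hx0.ne' hp0.ne']
        have h2 : (k : ℝ) * Real.log Y ≤ k * Real.log p := by gcongr
        linarith
      refine (hX₀' (X / p) p (hYX₀'.trans (hYp.trans hpp)) hp2 hpp hlogXp hqp d d' hd hd').trans ?_
      calc ε / K * (X / p) / Real.log p = ε / K * X / Real.log p * (p : ℝ)⁻¹ := by field_simp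
        _ ≤ ε / K * X / Real.log Y * (p : ℝ)⁻¹ := by gcongr
    · -- `p² > X`: both cells are empty
      have hempty : (roughIcc ⌈(p : ℝ)⌉₊ ⌊X / p⌋₊).filter (fun b => Ω b = i + 1) = ∅ := by
        rw [Nat.ceil_natCast, Nat.floor_div_natCast]
        refine roughIcc_filter_cardFactors_eq_empty ?_
        have h1 : (⌊X⌋₊ : ℝ) < p * p := (Nat.floor_le hx0.le).trans_lt ((div_lt_iff₀ hp0).mp hpp)
        have h2 : ⌊X⌋₊ < p * p := by exact_mod_cast h1
        exact ((Nat.div_lt_iff_lt_mul hpP.pos).mpr h2).trans_le (Nat.le_self_pow (Nat.succ_ne_zero i) p)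
      rw [hempty]
      simp only [Finset.filter_empty, Finset.card_empty, Nat.cast_zero, sub_self, abs_zero]
      positivity
  -- `∑_{Y ≤ p ≤ X} 1/p ≤ K - 1` (`a = ⌈Y⌉ - 1 ≥ e`, `log X ≤ k log Y ≤ 2k log a`)
  have hsum : ∑ p ∈ (Ico ⌈Y⌉₊ (⌊X⌋₊ + 1)).filter Nat.Prime, (p : ℝ)⁻¹ ≤
      (1 + 2 * C₀) * (2 * k) + 2 * C₀ := by
    set a : ℝ := ((⌈Y⌉₊ - 1 : ℕ) : ℝ) with ha
    have haN : a = (⌈Y⌉₊ : ℝ) - 1 := by rw [ha, Nat.cast_sub hN1, Nat.cast_one]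
    have hS : (Ico ⌈Y⌉₊ (⌊X⌋₊ + 1)).filter Nat.Prime = (Ioc ⌊a⌋₊ ⌊X⌋₊).filter Nat.Prime := by
      rw [ha, Nat.floor_natCast]
      congr 1
      ext p
      simp only [Finset.mem_Ico, Finset.mem_Ioc]
      omega
    have hay : Y - 1 ≤ a := by rw [haN]; linarith
    have hea : Real.exp 1 ≤ a := by have := Real.exp_one_lt_d9; linarith
    have hla : 1 ≤ Real.log a := (Real.le_log_iff_exp_le ((Real.exp_pos 1).trans_le hea)).2 hea
    have hab : a ≤ X := by rw [haN]; linarith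
    have hlya : Real.log Y ≤ 2 * Real.log a := by
      have h2 : (Y - 1) ^ 2 ≤ a ^ 2 := pow_le_pow_left₀ (by linarith) hay 2
      have h3 : Y ≤ (Y - 1) ^ 2 := by nlinarith
      calc Real.log Y ≤ Real.log (a ^ 2) := Real.log_le_log hy0 (h3.trans h2)
        _ = 2 * Real.log a := by rw [Real.log_pow]; norm_num
    have hlXa : Real.log X / Real.log a ≤ 2 * k := by
      rw [div_le_iff₀ (by linarith)]
      calc Real.log X ≤ k * Real.log Y := hlog
        _ ≤ k * (2 * Real.log a) := by gcongr
        _ = 2 * k * Real.log a := by ring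
    rw [hS]
    calc ∑ p ∈ (Ioc ⌊a⌋₊ ⌊X⌋₊).filter Nat.Prime, (p : ℝ)⁻¹
        ≤ (1 + 2 * C₀) * (Real.log X / Real.log a) + 2 * C₀ :=
          Literature.NumberTheory.LFunctions.sum_primes_Ioc_inv_le hea hab hC₀ hE
      _ ≤ (1 + 2 * C₀) * (2 * k) + 2 * C₀ := by gcongr
  rw [hB c, hB c', ← Finset.sum_sub_distrib]
  calc _ ≤ ∑ p ∈ (Ico ⌈Y⌉₊ (⌊X⌋₊ + 1)).filter Nat.Prime, ε / K * X / Real.log Y * (p : ℝ)⁻¹ :=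
        (Finset.abs_sum_le_sum_abs _ _).trans (Finset.sum_le_sum hterm)
    _ = ε / K * X / Real.log Y * ∑ p ∈ (Ico ⌈Y⌉₊ (⌊X⌋₊ + 1)).filter Nat.Prime, (p : ℝ)⁻¹ := by
        rw [Finset.mul_sum]
    _ ≤ ε / K * X / Real.log Y * ((1 + 2 * C₀) * (2 * k) + 2 * C₀) := by gcongr
    _ ≤ ε / K * X / Real.log Y * K := by gcongr; linarith
    _ = ε * X / Real.log Y := by field_simp

/-- **(A) Differences of reduced classes of an `Ω`-cell are `o(X/log Y)`**: for `q ≥ 1`, `i, k`,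
`ε > 0` there is `X₀` with `|#{b ∈ cell : b ≡ c} − #{b ∈ cell : b ≡ c'}| ≤ ε X/log Y` for `X ≥ X₀`,
`2 ≤ Y ≤ X ≤ Y^k`, `Y > q`, `c, c'` reduced, `cell = {b ∈ roughIcc ⌈Y⌉₊ ⌊X⌋₊ : Ω b = i+1}`. -/
private theorem abs_card_cell_class_sub_le {q : ℕ} (hq : 0 < q) (i : ℕ) :
    ∀ (k : ℕ) (ε : ℝ), 0 < ε → ∃ X₀ : ℝ, ∀ X Y : ℝ, X₀ ≤ X → 2 ≤ Y → Y ≤ X →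
      Real.log X ≤ k * Real.log Y → (q : ℝ) < Y → ∀ c c' : ℕ, c.Coprime q → c'.Coprime q →
        |(#(((roughIcc ⌈Y⌉₊ ⌊X⌋₊).filter (fun b => Ω b = i + 1)).filter (· ≡ c [MOD q])) : ℝ) -
            #(((roughIcc ⌈Y⌉₊ ⌊X⌋₊).filter (fun b => Ω b = i + 1)).filter (· ≡ c' [MOD q]))| ≤
          ε * X / Real.log Y := by
  induction i with
  | zero => exact fun k ε hε => abs_card_cell_class_sub_le_base hq k hε
  | succ j ih => exact fun k ε hε => abs_card_cell_class_sub_le_step hq j ih k hε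

/-- **Stub `stub_apCells` (registered): Alladi's Ω-cell asymptotic in a fixed residue class —
`APCellAsymptotic`, unfolded.** For `q ≥ 1`, every `i, k` and `ε > 0` there is `X₀` such that,
uniformly in `r` prime to `q` and in `2 ≤ Y ≤ X ≤ Y^k`, `X ≥ X₀`:
`|#{n ≤ X : n ≡ r (q), P⁻(n) ≥ ⌈Y⌉, Ω(n) = i+1} − (X I_{i+1}(log X/log Y)/log X − [i=0] Y/log Y)/φ(q)| ≤ ε X/log Y`.
The counted set is the class `r` of the `Ω = i+1` cell of `roughIcc ⌈Y⌉₊ ⌊X⌋₊`, the `φ(q)` reduced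
classes partition the cell (`Y > q`), of size `main ± C X/log² Y` (`stub_cellRate stub_calculus`), two
classes differ by `≤ (ε/2) X/log Y`, and `C X/log² Y ≤ (ε/2) X/log Y` as `log Y ≥ 2 max(C,1)/ε`. -/
theorem stub_apCells :
    (∀ q : ℕ, 1 ≤ q → ∀ i k : ℕ, ∀ ε : ℝ, 0 < ε → ∃ X₀ : ℝ, ∀ r : ℕ, r.Coprime q →
      ∀ X Y : ℝ, 2 ≤ Y → Y ≤ X → X₀ ≤ X → Real.log X ≤ k * Real.log Y →
        |((((Finset.Icc 1 ⌊X⌋₊).filter (fun n => n ≡ r [MOD q] ∧ ⌈Y⌉₊ ≤ Nat.minFac n ∧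
              ArithmeticFunction.cardFactors n = i + 1)).card : ℕ) : ℝ) -
            (X * cellDensity i (Real.log X / Real.log Y) / Real.log X -
                if i = 0 then Y / Real.log Y else 0) / (Nat.totient q : ℝ)| ≤
          ε * X / Real.log Y) := by
  intro q hq i k ε hε
  have hq0 : 0 < q := hq
  obtain ⟨C, hC⟩ := stub_cellRate stub_calculus i k
  obtain ⟨X₀', hD⟩ := abs_card_cell_class_sub_le hq0 i k (ε / 2) (half_pos hε)
  set C' : ℝ := max C 1 with hC'
  have hC'0 : 0 < C' := lt_of_lt_of_le one_pos (le_max_right _ _)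
  set X₁ : ℝ := max (max X₀' (Real.exp (2 * C' / ε))) ((q : ℝ) + 4) with hX₁
  have hX₁0 : 0 < X₁ := lt_of_lt_of_le (by positivity) (le_max_right _ _)
  refine ⟨X₁ ^ k, fun r hr X Y hY2 hYX hX hlog => ?_⟩
  have hX₁Y : X₁ ≤ Y := le_of_pow_le_of_log_le hX₁0 hY2 hYX hX hlog
  have hYX₀' : X₀' ≤ Y := le_trans (le_trans (le_max_left _ _) (le_max_left _ _)) hX₁Y
  have hYexp : Real.exp (2 * C' / ε) ≤ Y := le_trans (le_trans (le_max_right _ _) (le_max_left _ _)) hX₁Y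
  have hqY : (q : ℝ) < Y := by have := le_trans (le_max_right _ _) hX₁Y; linarith
  have hy0 : 0 < Y := by linarith
  have hx0 : 0 < X := by linarith
  have hly : 0 < Real.log Y := Real.log_pos (by linarith)
  have hqN : q < ⌈Y⌉₊ := by
    have : (q : ℝ) < ⌈Y⌉₊ := hqY.trans_le (Nat.le_ceil Y)
    exact_mod_cast this
  have hφ0 : (0 : ℝ) < q.totient := by exact_mod_cast Nat.totient_pos.mpr hq0
  have hφ1 : (1 : ℝ) ≤ q.totient := by exact_mod_cast Nat.totient_pos.mpr hq0
  have hRcard : ((#((range q).filter (Nat.Coprime q)) : ℕ) : ℝ) = (q.totient : ℝ) := by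
    exact_mod_cast RoughAP.card_range_filter_coprime q
  -- (B) the total against the main term
  have hrate := hC X Y hY2 hYX hlog
  rw [omegaCell_succ_eq_card_filter, card_eq_sum_card_filter_of_subset hq0 hqN
    (Finset.filter_subset (fun b => Ω b = i + 1) (roughIcc ⌈Y⌉₊ ⌊X⌋₊)), Nat.cast_sum] at hrate
  -- (A) the differences with the class `r`
  have hdiff : ∀ c ∈ (range q).filter (Nat.Coprime q),
      |(#(((roughIcc ⌈Y⌉₊ ⌊X⌋₊).filter (fun b => Ω b = i + 1)).filter (· ≡ r [MOD q])) : ℝ) -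
          #(((roughIcc ⌈Y⌉₊ ⌊X⌋₊).filter (fun b => Ω b = i + 1)).filter (· ≡ c [MOD q]))| ≤
        ε / 2 * X / Real.log Y :=
    fun c hc => hD X Y (hYX₀'.trans hYX) hY2 hYX hlog hqY r c hr (Nat.Coprime.symm (mem_filter.mp hc).2)
  rw [filter_class_cell_eq q r ⌈Y⌉₊ ⌊X⌋₊ i]
  refine (abs_sub_div_le_of_sum _ _ hRcard hφ0 hrate hdiff).trans ?_
  have hC'le : C' ≤ ε / 2 * Real.log Y := by
    have hlogY := (div_le_iff₀ hε).mp ((Real.le_log_iff_exp_le hy0).mpr hYexp)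
    linarith
  have hsmall : C' * X / Real.log Y ^ 2 ≤ ε / 2 * X / Real.log Y := by
    rw [div_le_div_iff₀ (by positivity) hly]
    calc C' * X * Real.log Y = C' * (X * Real.log Y) := by ring
      _ ≤ ε / 2 * Real.log Y * (X * Real.log Y) := by gcongr
      _ = ε / 2 * X * Real.log Y ^ 2 := by ring
  have hE : C * X / Real.log Y ^ 2 / (q.totient : ℝ) ≤ ε / 2 * X / Real.log Y := by
    have h1 : C * X / Real.log Y ^ 2 ≤ C' * X / Real.log Y ^ 2 := by
      rw [mul_div_assoc, mul_div_assoc]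
      exact mul_le_mul_of_nonneg_right (le_max_left _ _) (by positivity)
    calc C * X / Real.log Y ^ 2 / (q.totient : ℝ) ≤ C' * X / Real.log Y ^ 2 / (q.totient : ℝ) := by
          gcongr
      _ ≤ C' * X / Real.log Y ^ 2 := div_le_self (by positivity) hφ1
      _ ≤ ε / 2 * X / Real.log Y := hsmall
  calc ε / 2 * X / Real.log Y + C * X / Real.log Y ^ 2 / (q.totient : ℝ)
      ≤ ε / 2 * X / Real.log Y + ε / 2 * X / Real.log Y := by linarith
    _ = ε * X / Real.log Y := by ring

end Summit.Parity.GeneralizedHardyLittlewood.Cruxes.FibreHyperbolicity.ModelTransfer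

end
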